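import Summits.NavierStokesRegularity.NavierStokesRegularity.Theorems.QuietScarPocketDoorLZoom
import Summits.NavierStokesRegularity.NavierStokesRegularity.Theorems.QuietScarPocketDoorLTraceVelocity
import Summits.NavierStokesRegularity.NavierStokesRegularity.Theorems.QuietScarPocketDoorLFrame
import Summits.NavierStokesRegularity.NavierStokesRegularity.Theorems.QuietScarPocketDoorLStrainRigidity
import Summits.NavierStokesRegularity.NavierStokesRegularity.Theorems.QuietScarPocketDoorLPlanarRigidity
import Summits.NavierStokesRegularity.NavierStokesRegularity.Theorems.QuietScarPocketDoorLCombRigidity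

/-!
# QuietScarPocketDoorLSchema — §B «L-POCKET SCHEMA» of door S31 CLOSED BY NAME: the schema and its three instance doors
# (texts nsreg-p1 g25 `r29/Sketch31D.lean` 8bb56c0a84466268 = tree `QuietScarPocketDoorLPocketDefs`)

Closers only (kernel compositions, no new analysis).  Seat nsreg-C26-p1 g4 on the S-door lane (LEAD ns-s30-p1 g2; DIRECTOR-NS
#209 (2); closers handed to this seat by ns-imp-p1 g4 2026-08-28T11:38:19Z); `--supports stmt-NavierStokesRegularity-0056 --as helper`.

* `lPocketSchema_holds : LPocketSchema` — for EVERY continuous linear constraint `L` on velocity gradients with the static rigidity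
  `StaticLRigidity L`, DOOR_L holds in the Pineau–Vicol frame (P1 `lPocketZoom_holds`, ns-imp-p1 g4 p629867; P2
  `terminalTraceAnalyticVelocity_holds`, ns-s30-p1-w1 g0 p629302; composition `lPocketSchema_of_terminalTraceAnalyticVelocity`);
* `targetStrainPocket_holds : TargetStrainPocket` («a one-point Type-I blow-up STRAINS every pocket at the blow-up time»;
  rigidity P4 `strainRigidity_holds` p629538, frame P3 `frameTransferL_holds` ns-imp-p1 g4 p630039);
* `targetPlanarPocket_holds : TargetPlanarPocket` («nowhere locally 2D»; rigidity P5 `planarRigidity_holds` p629570);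
* `targetCombedPocket_holds : TargetCombedPocket` («the vorticity direction TWISTS in every pocket»; rigidity P6
  `combRigidity_holds` p629930).

HONEST FRAME: corollary SCHEMA of the S31 regularity CRITERION — statements about HYPOTHETICAL one-point Type-I blow-up profiles
(criterion form: a Type-I point carrying an `ε`-quiet `L`-pocket is regular); the hard core 0056 `NoTypeII` is NOT touched and
Navier–Stokes regularity is NOT proved.
-/

noncomputable section

set_option linter.dupNamespace false

namespace Summit.NavierStokesRegularity.NavierStokesRegularity.Theorems.QuietScarPocketDoor

open Literature.Analysis Literature.Analysis.FluidPDE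

/-- **The L-pocket SCHEMA holds**: for every continuous linear constraint `L` on velocity gradients whose static rigidity
`StaticLRigidity L` holds, DOOR_L holds in the Pineau–Vicol frame (`PVLPocketRegularity L`). [composition] -/
theorem lPocketSchema_holds : LPocketSchema :=
  lPocketSchema_of_terminalTraceAnalyticVelocity terminalTraceAnalyticVelocity_holds

/-- **Door «STRAIN-QUIET pocket» CLOSED BY NAME (`TargetStrainPocket`)**: a one-point Type-I blow-up cannot carry, arbitrarily
close to the apex, a pocket on which the strain `∇u + ∇uᵀ` is eventually `ε`-quiet at the critical rate. [composition] -/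
theorem targetStrainPocket_holds : TargetStrainPocket :=
  targetStrainPocket_of (lPocketZoom_holds _ strainCLM) terminalTraceAnalyticVelocity_holds strainRigidity_holds
    (frameTransferL_holds _ strainCLM)

/-- **Door «PLANAR pocket» CLOSED BY NAME (`TargetPlanarPocket`)**: for every unit vector `e`, a one-point Type-I blow-up cannot
carry, arbitrarily close to the apex, a pocket on which `∂ₑu` is eventually `ε`-quiet at the critical rate («nowhere locally
2D»). [composition] -/
theorem targetPlanarPocket_holds : TargetPlanarPocket :=
  targetPlanarPocket_of (fun e _ => lPocketZoom_holds _ (planarCLM e)) terminalTraceAnalyticVelocity_holds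
    planarRigidity_holds (fun e _ => frameTransferL_holds _ (planarCLM e))

/-- **Door «COMBED pocket» CLOSED BY NAME (`TargetCombedPocket`)**: for every unit vector `e`, a one-point Type-I blow-up cannot
carry, arbitrarily close to the apex, a pocket on which the part of the vorticity orthogonal to `e` is eventually `ε`-quiet at the
critical rate («the vorticity direction twists in every pocket»). [composition] -/
theorem targetCombedPocket_holds : TargetCombedPocket :=
  targetCombedPocket_of (fun e _ => lPocketZoom_holds _ (combCLM e)) terminalTraceAnalyticVelocity_holds
    combRigidity_holds (fun e _ => frameTransferL_holds _ (combCLM e))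

end Summit.NavierStokesRegularity.NavierStokesRegularity.Theorems.QuietScarPocketDoor

end
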